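import Literature.AnabelianGeometry.EtaleTheta.ThetaSettingZNFromSplitting
import Literature.AnabelianGeometry.EtaleTheta.SettingModelChiDoubleUnderline
import Literature.AnabelianGeometry.EtaleTheta.SettingModelChiTate2
import Literature.AnabelianGeometry.EtaleTheta.SettingModelChiTwistedSections
import Literature.AnabelianGeometry.EtaleTheta.SettingModelThetaCentreZHat
import Literature.AnabelianGeometry.EtaleTheta.SettingModelPowHat
import Literature.AnabelianGeometry.EtaleTheta.SettingGaloisFacts
import HarnessLib

/-!
# The χ-model: `N·(Δ^tp_Y)^Θ` in level coordinates, and the origin clause for `Z_N` HOLDS for the standard splitting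
# (NV sizing of abc-iut-L2-t1's `GtpZNFromSplitting`; proof-only)

Mochizuki, *The étale theta function …*, Publ. RIMS **45** (2009) [EtTh], §1 p. 13–14 (kurims p. 13 l. 25–46): «any two
splittings of `(Π^tp_{Y_N})^Θ/N·(Δ^tp_Y)^Θ ↠ G_{K_N}` … determine the same splitting over `G_{J_N}` … whose kernel we denote
by `Π^tp_{Z_N}`» [cite: MochizukiEtTh2009, §1 p.14].  abc-iut cell, layer L2, prover abc-iut-L2-d1 (gen 5); PROOF-ONLY
model-side sizing (my FINDING F-L2d1g5-1, 13:17Z) of abc-iut-L2-t1's origin clause `ThetaSetting.GtpZNFromSplitting`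
(`ThetaSettingZNFromSplitting`, p446335) at abc-iut-L2-t1's `ThetaSetting.modelχ p` (`Π^tp_X = Γ ⋊_χ G_{ℚ_p}`,
`Π^tp_{Y_N} = Δ^tp_{Y_N} ⋊ G_{K_N}`, `Π^tp_{Z_N} = Δ^tp_{Z_N} ⋊ G_{J_N}` with `Δ^tp_{Z_N} = Ker pr₂ ∩ Ker ĥ_N`):

* **`toTheta_inl_mem_thetaPowersY_iff`** — for `γ ∈ Ker pr₂`: `θ(inl γ) ∈ N·(Δ^tp_Y)^Θ ↔ ĥ_N(γ) = 1` (`(Δ^tp_Y)^Θ ≅ Ẑ²`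
  by the level-compatible coordinates `ŷ = ê_b`, `ẑ`; an element with level-`N` shadow `1` is the `N`-th power of
  `θ(inl(b^s c^u))`, `s^N = ŷ`, `u^N = ẑ`; conversely `N`-th powers of `(Δ^tp_Y)^Θ` have trivial level-`N` shadow:
  `(0, y, z)^N = (0, Ny, Nz)`);
* **`isThetaSplittingAt_inr_modelχ`** — the STANDARD splitting `σ ↦ θ(inr σ)` over `G_{K_N}` is a lifted splitting;
* **`gtpZN_iff_of_inr_splitting_modelχ`** — and FOR IT the clause of `GtpZNFromSplitting` holds on the nose:
  `g ∈ Π^tp_{Z_N} ↔ g ∈ Π^tp_{Y_N} ∧ aug g ∈ G_{J_N} ∧ θ(g)·θ(inr(aug g))⁻¹ ∈ N·(Δ^tp_Y)^Θ`;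
  `exists_thetaSplitting_gtpZN_iff_modelχ` (∃-form).
What is NOT claimed: `GtpZNFromSplitting (modelχ p) N` itself (ALL splittings): any other splitting differs from the
standard one by an ABSTRACT homomorphism `G_{K_N} → (ℤ/N)²` (`IsThetaSplittingAt` carries no continuity), whose vanishing
on `G_{J_N}` is Kummer theory for continuous ones and needs «finite-index subgroups of `G_{K_N}` are open» in general.
SEMI-SYNTHETIC MODEL, consistency evidence only; nothing of [EtTh] asserted; no side taken on [IUTchIII] Cor. 3.12.
-/

noncomputable section

namespace Literature.AnabelianGeometry.EtaleTheta.SettingModel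

open Literature.AnabelianGeometry.SemiGraphs _root_.Function

variable (p : ℕ) [Fact p.Prime] (N : ℕ+)

/-! ### Level-`N` shadows of `N`-th powers -/

/-- `ĥ_N(γ^N) = 1` for `γ ∈ Ker pr₂` (`(0, y, z)^N = (0, Ny, Nz) = 1` mod `N`). [cite: MochizukiEtTh2009, §1 p.14] -/
theorem levelHom_pow_eq_one_of_mem_ker {γ : Gfp} (hγ : γ ∈ gfpSnd.ker) : levelHom N (γ ^ (N : ℕ)) = 1 := by
  rw [map_pow, Heis.pow_eq_of_x_eq_zero _ (levelHom_x_eq_zero hγ), ZMod.natCast_self, zero_mul, zero_mul]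
  rfl

/-- `γ^N ∈ Δ^tp_{Z_N}` for `γ ∈ Ker pr₂`. [cite: MochizukiEtTh2009, §1 p.14] -/
theorem pow_mem_dZ_of_mem_ker {γ : Gfp} (hγ : γ ∈ gfpSnd.ker) : γ ^ (N : ℕ) ∈ dZ N :=
  Subgroup.mem_inf.mpr ⟨pow_mem hγ _, by
    rw [MonoidHom.mem_ker]
    exact levelHom_pow_eq_one_of_mem_ker N hγ⟩

/-- Equal images in `(Π^tp_X)^Θ` of `inl γ`, `inl γ′` force equal level shadows. [cite: MochizukiEtTh2009, §1 p.12] -/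
theorem levelHom_eq_of_toTheta_inl_eq {γ γ' : Gfp}
    (h : CurveTheta.toTheta (curveχ p) (SemidirectProduct.inl γ) =
      CurveTheta.toTheta (curveχ p) (SemidirectProduct.inl γ')) (M : ℕ+) :
    levelHom M γ = levelHom M γ' := by
  rw [CurveTheta.toTheta, QuotientGroup.mk'_apply, QuotientGroup.mk'_apply, QuotientGroup.eq_iff_div_mem,
    ← map_div, mem_thetaKerχ_iff] at h
  have h1 := h.1 M
  rw [SemidirectProduct.left_inl, map_div, map_div] at h1
  exact div_eq_one.mp h1

/-! ### `N·(Δ^tp_Y)^Θ` at the χ-model -/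

/-- **`N·(Δ^tp_Y)^Θ ≤ θ(inl(Δ^tp_{Z_N}))`**: the `N`-th powers of `(Δ^tp_Y)^Θ = θ(inl(Ker pr₂))` are images of `N`-th
powers, whose level-`N` shadow is trivial. [cite: MochizukiEtTh2009, §1 p.14] -/
theorem thetaPowersY_modelχ_le :
    (ThetaSetting.modelχ p).thetaPowersY N ≤
      (dZ N).map ((CurveTheta.toTheta (curveχ p)).comp (SemidirectProduct.inl : Gfp →* PiTpχ p)) := by
  rw [ThetaSetting.thetaPowersY, Subgroup.closure_le]
  rintro _ ⟨y, hy, rfl⟩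
  obtain ⟨g, hg, rfl⟩ := hy
  obtain ⟨hr, hs, -⟩ := right_eq_one_and_eHat_eq_one_of_mem_dtpY p hg
  have hg' : g = SemidirectProduct.inl g.left := by
    rw [← SemidirectProduct.inl_left_mul_inr_right g, hr, map_one, mul_one]
    rfl
  refine ⟨g.left ^ (N : ℕ), pow_mem_dZ_of_mem_ker N hs, ?_⟩
  change CurveTheta.toTheta (curveχ p) (SemidirectProduct.inl (g.left ^ (N : ℕ))) =
    CurveTheta.toTheta (curveχ p) g ^ (N : ℕ)
  rw [map_pow, map_pow, ← hg']

/-- **`θ(inl(Δ^tp_{Z_N})) ≤ N·(Δ^tp_Y)^Θ`**: an element `γ ∈ Ker pr₂` with `ĥ_N(γ) = 1` has `Ẑ`-coordinates `ŷ = s^N`,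
`ẑ = u^N`, and `θ(inl γ) = θ(inl(b^s c^u))^N`. [cite: MochizukiEtTh2009, §1 p.14] -/
theorem toTheta_inl_mem_thetaPowersY_of_mem_dZ {γ : Gfp} (hγ : γ ∈ dZ N) :
    CurveTheta.toTheta (curveχ p) (SemidirectProduct.inl γ) ∈ (ThetaSetting.modelχ p).thetaPowersY N := by
  obtain ⟨hs, hl⟩ := Subgroup.mem_inf.mp hγ
  rw [MonoidHom.mem_ker] at hl
  -- the `Ẑ`-valued `z`-coordinate of `γ₁`
  obtain ⟨t, ht⟩ := exists_zHat_forall_hHat_z_eq (gfpFst γ)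
  have hy : ZHatLevel.level N (eHatB (gfpFst γ)) = 1 := by
    rw [← modN_eq_level, ← hHat_y_eq_zero_iff]
    change (levelHom N γ).y = 0
    rw [hl]
    rfl
  have htN : ZHatLevel.level N t = 1 := by
    have h := ht N
    change _ = (levelHom N γ).z at h
    rw [hl] at h
    rw [← modN_eq_level, ← ofAdd_toAdd (modN N t), h]
    rfl
  obtain ⟨s, hs'⟩ := (ZHatLevel.level_eq_one_iff_exists_pow N _).mp hy
  obtain ⟨u, hu⟩ := (ZHatLevel.level_eq_one_iff_exists_pow N _).mp htN
  have hδ : bPowGfp s * cGfpχ u ∈ gfpSnd.ker := by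
    rw [MonoidHom.mem_ker, map_mul, gfpSnd_bPowGfp, one_mul]
    rfl
  have hδY : (SemidirectProduct.inl (bPowGfp s * cGfpχ u) : PiTpχ p) ∈ (ThetaSetting.modelχ p).DtpY :=
    (inl_mem_dtpY_modelχ_iff p _).mpr hδ
  have key : CurveTheta.toTheta (curveχ p) (SemidirectProduct.inl γ) =
      CurveTheta.toTheta (curveχ p) (SemidirectProduct.inl ((bPowGfp s * cGfpχ u) ^ (N : ℕ))) := by
    refine toTheta_eq_of_right_eq_one p _ _ (SemidirectProduct.right_inl _) (SemidirectProduct.right_inl _) ?_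
    rw [mem_closure_commutator₃_iff_forall_hHat]
    intro M
    rw [SemidirectProduct.left_inl, SemidirectProduct.left_inl, map_mul, map_inv]
    change levelHom M γ * (levelHom M ((bPowGfp s * cGfpχ u) ^ (N : ℕ)))⁻¹ = 1
    rw [mul_inv_eq_one, map_pow, map_mul, levelHom_bPowGfp]
    change hHat M (gfpFst γ) = (_ * hHat M (gfpFst (cGfpχ u))) ^ (N : ℕ)
    have hx0 : ((⟨0, Multiplicative.toAdd (ZHatLevel.level M s), 0⟩ : Heis (ZMod M)) *
        hHat M (gfpFst (cGfpχ u))).x = 0 := by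
      rw [gfpFst_cGfpχ, hHat_powHat_commutator, Heis.mul_x, add_zero]
    rw [Heis.pow_eq_of_x_eq_zero _ hx0, gfpFst_cGfpχ, hHat_powHat_commutator]
    have hyM : (hHat M (gfpFst γ)).y = (N : ZMod M) * Multiplicative.toAdd (ZHatLevel.level M s) := by
      have h := hHat_y_eq_modN_eHatB M (gfpFst γ)
      rw [← hs', modN_eq_level, map_pow] at h
      rw [← toAdd_ofAdd (hHat M (gfpFst γ)).y, h, toAdd_pow, nsmul_eq_mul]
    have hzM : (hHat M (gfpFst γ)).z = (N : ZMod M) * Multiplicative.toAdd (ZHatLevel.level M u) := by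
      rw [← ht M, ← hu, modN_eq_level, map_pow, toAdd_pow, nsmul_eq_mul]
    ext
    · change (levelHom M γ).x = _
      rw [levelHom_x_eq_zero hs]
    · rw [hyM, Heis.mul_y, add_zero]
    · rw [hzM, Heis.mul_z, zero_mul, add_zero, zero_add]
  rw [key, map_pow, map_pow]
  exact Subgroup.subset_closure ⟨_, ⟨_, hδY, rfl⟩, rfl⟩


/-- **`N·(Δ^tp_Y)^Θ` in level coordinates**: for `γ ∈ Ker pr₂`, `θ(inl γ) ∈ N·(Δ^tp_Y)^Θ ↔ ĥ_N(γ) = 1` (i.e.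
`γ ∈ Δ^tp_{Z_N}`). [cite: MochizukiEtTh2009, §1 p.14] -/
theorem toTheta_inl_mem_thetaPowersY_iff {γ : Gfp} (hγ : γ ∈ gfpSnd.ker) :
    CurveTheta.toTheta (curveχ p) (SemidirectProduct.inl γ) ∈ (ThetaSetting.modelχ p).thetaPowersY N ↔
      levelHom N γ = 1 := by
  constructor
  · intro h
    obtain ⟨γ', hγ', hEq⟩ := thetaPowersY_modelχ_le p N h
    rw [← levelHom_eq_of_toTheta_inl_eq p hEq N]
    exact (Subgroup.mem_inf.mp hγ').2
  · intro h
    exact toTheta_inl_mem_thetaPowersY_of_mem_dZ p N (Subgroup.mem_inf.mpr ⟨hγ, h⟩)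

/-! ### The standard splitting and the `Z_N`-clause for it -/

/-- **The standard lifted splitting `σ ↦ θ(inr σ)` over `G_{K_N}`** of the χ-model is a lifted splitting in the sense of
abc-iut-L2-t1's `IsThetaSplittingAt` (values lifted from `inr σ ∈ Π^tp_{Y_N}`, multiplicative on the nose).
[cite: MochizukiEtTh2009, §1 p.14] -/
theorem isThetaSplittingAt_inr_modelχ :
    (ThetaSetting.modelχ p).IsThetaSplittingAt N
      (fun σ => (ThetaSetting.modelχ p).toTheta (SemidirectProduct.inr (σ : GQp p))) where
  exists_lift σ := ⟨SemidirectProduct.inr (σ : GQp p), inr_mem_YNχ p N σ.2, rfl, rfl⟩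
  map_mul_mem σ τ := by
    show (ThetaSetting.modelχ p).toTheta (SemidirectProduct.inr ((σ * τ : ↥((ThetaSetting.modelχ p).GKN N)) : GQp p)) *
        ((ThetaSetting.modelχ p).toTheta (SemidirectProduct.inr (σ : GQp p)) *
          (ThetaSetting.modelχ p).toTheta (SemidirectProduct.inr (τ : GQp p)))⁻¹ ∈ _
    rw [Subgroup.coe_mul, map_mul, map_mul, mul_inv_cancel]
    exact Subgroup.one_mem _

/-- `g · (inr g.right)⁻¹ = inl g.left` in `Γ ⋊ G`. [cite: MochizukiEtTh2009, §1 p.12] -/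
theorem mul_inv_inr_right_eq_inl (g : PiTpχ p) :
    g * (SemidirectProduct.inr g.right)⁻¹ = SemidirectProduct.inl g.left := by
  rw [← map_inv]
  refine SemidirectProduct.ext ?_ ?_
  · rw [SemidirectProduct.mul_left, SemidirectProduct.left_inr, map_one, mul_one, SemidirectProduct.left_inl]
  · rw [SemidirectProduct.mul_right, SemidirectProduct.right_inr, mul_inv_cancel, SemidirectProduct.right_inl]

/-- **The clause of `GtpZNFromSplitting` HOLDS at the χ-model for the standard splitting**: `g ∈ Π^tp_{Z_N}` iff
`g ∈ Π^tp_{Y_N}`, `aug g ∈ G_{J_N}` and `θ(g)·θ(inr(aug g))⁻¹ = θ(inl g.left) ∈ N·(Δ^tp_Y)^Θ` (= `ĥ_N(g.left) = 1`).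
[cite: MochizukiEtTh2009, §1 p.14] -/
theorem gtpZN_iff_of_inr_splitting_modelχ (g : PiTpχ p) :
    g ∈ (ThetaSetting.modelχ p).GtpZN N ↔
      g ∈ (ThetaSetting.modelχ p).GtpYN N ∧ ∃ h : (ThetaSetting.modelχ p).aug g ∈ (ThetaSetting.modelχ p).GJN N,
        (ThetaSetting.modelχ p).toTheta g *
          ((fun σ : ↥((ThetaSetting.modelχ p).GKN N) =>
              (ThetaSetting.modelχ p).toTheta (SemidirectProduct.inr (σ : GQp p)))
            ⟨(ThetaSetting.modelχ p).aug g, (ThetaSetting.modelχ p).GJN_le_GKN N h⟩)⁻¹ ∈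
          (ThetaSetting.modelχ p).thetaPowersY N := by
  constructor
  · intro hZ
    obtain ⟨hl, hr⟩ := (GfpTwistData.mem_ZN (chiTwistData p)).mp hZ
    refine ⟨(GfpTwistData.mem_YN (chiTwistData p)).mpr ⟨dZ_le_dY N hl, (ThetaSetting.modelχ p).GJN_le_GKN N hr⟩,
      hr, ?_⟩
    show CurveTheta.toTheta (curveχ p) g * (CurveTheta.toTheta (curveχ p) (SemidirectProduct.inr g.right))⁻¹ ∈ _
    rw [← map_inv, ← map_mul, mul_inv_inr_right_eq_inl]
    exact toTheta_inl_mem_thetaPowersY_of_mem_dZ p N hl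
  · rintro ⟨hY, hr, hmem⟩
    obtain ⟨hl, -⟩ := (GfpTwistData.mem_YN (chiTwistData p)).mp hY
    have hs : g.left ∈ gfpSnd.ker := (Subgroup.mem_inf.mp hl).1
    change CurveTheta.toTheta (curveχ p) g * (CurveTheta.toTheta (curveχ p) (SemidirectProduct.inr g.right))⁻¹ ∈ _
      at hmem
    rw [← map_inv, ← map_mul, mul_inv_inr_right_eq_inl] at hmem
    exact (GfpTwistData.mem_ZN (chiTwistData p)).mpr
      ⟨Subgroup.mem_inf.mpr ⟨hs, (toTheta_inl_mem_thetaPowersY_iff p N hs).mp hmem⟩, hr⟩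

/-- **∃-form (NV sizing of `GtpZNFromSplitting` at the χ-model)**: there IS a lifted splitting over `G_{K_N}` for which
the printed characterisation of `Π^tp_{Z_N}` holds at the χ-model (the universally quantified predicate itself is not
claimed — see the header). [cite: MochizukiEtTh2009, §1 p.14] -/
theorem exists_thetaSplitting_gtpZN_iff_modelχ :
    ∃ s : ↥((ThetaSetting.modelχ p).GKN N) → (ThetaSetting.modelχ p).GtpTheta,
      (ThetaSetting.modelχ p).IsThetaSplittingAt N s ∧
        ∀ g : PiTpχ p, g ∈ (ThetaSetting.modelχ p).GtpZN N ↔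
          g ∈ (ThetaSetting.modelχ p).GtpYN N ∧ ∃ h : (ThetaSetting.modelχ p).aug g ∈ (ThetaSetting.modelχ p).GJN N,
            (ThetaSetting.modelχ p).toTheta g * (s ⟨(ThetaSetting.modelχ p).aug g, (ThetaSetting.modelχ p).GJN_le_GKN N h⟩)⁻¹ ∈
              (ThetaSetting.modelχ p).thetaPowersY N :=
  ⟨_, isThetaSplittingAt_inr_modelχ p N, gtpZN_iff_of_inr_splitting_modelχ p N⟩

end Literature.AnabelianGeometry.EtaleTheta.SettingModel

end
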